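import Mathlib
import HarnessLib

/-!
# The single-cycle re-blocking inequality (T2, step S4 — abstract cycle model, UNCONDITIONAL)

Abstract combinatorial model of ONE alternating component of `std ∪ π` (qa-dq-idea-2 g13, line
`frozen-pairing-extremality-law`, SKETCH.md §3.2–3.4).  Positions of a `2k`-cycle are `ZMod k × Bool`
(`(i, false)`, `(i, true)` = the two wires of standard block `i`; the `π`-block `i` is `{(i, true), (i+1, false)}`).
For a word `x : ZMod k × Bool → Bool`: `occStd x` / `occPi x` = occupied standard / `π`-blocks, `wt x` = number of
occupied positions, `mixStd x` / `mixPi x` = number of MIXED standard / `π`-blocks (= E-walls / O-walls).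

MAIN THEOREM `cycle_reblocking` (no hypotheses beyond the data): for every nonnegative SUB-CRITICAL block weight
`φ` (`φ (insert b B) ≤ 15 φ B`), every `s ≥ 0` and `0 ≤ y ≤ 1`,
`Σ_x s^{wt x} φ(occStd x) 15^{-#occStd x} y^{#occPi x} ≤ Σ_x s^{wt x} φ(occStd x) 15^{-#occStd x} y^{#occStd x}`.

PROOF (all kernel-checked, Mathlib only, no matrices — THIS file: the definitions and the counting identities; the sequels `BlockMixingReblockingCycleCount` (boundaries, the wall move `psi`, the cycle-lemma count), `BlockMixingReblockingCycleParity` (particle conservation, mirror symmetry) and `BlockMixingReblockingCycle` (the reduction `cycle_reblocking_of_wallMove`, injectivity, `wallMove`, `cycle_reblocking`) complete it):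
* counting `2·#occStd = wt + mixStd`, `2·#occPi = wt + mixPi`; antitonicity of `B ↦ φ B / 15^{#B}` (sub-criticality);
* `cycle_reblocking_of_wallMove`: the inequality follows from a WALL-MOVE INJECTION `WallMove k` (an injection on the
  BAD words `mixPi < mixStd` preserving `wt`, shrinking `occStd`, and swapping the two wall counts) by pairing each bad
  word with its image;
* THE WALL MOVE `psi`: move every UNMATCHED E-wall (cyclic bracket matching, E-walls open, O-walls close:
  `Unmatched x b` = all `2k` forward partial sums of the signed wall indicator from `b` are `≥ 1`) one boundary
  clockwise (copy the first wire of the block onto the second);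
* THE CYCLE-LEMMA COUNT `card_unmatched`: `#unmatched = mixStd − mixPi`, via the FUTURE-MINIMUM function `mu` of the
  height along the orbit of `next`, which is a unit-step staircase rising exactly across unmatched boundaries
  (`mu_succ`) and gains `mixStd − mixPi` per turn (`mu_add_period`) — a telescoping sum, no case analysis on arcs;
* the swapped counts `mixStd (psi x) = mixPi x`, `mixPi (psi x) = mixStd x` and `occStd (psi x) ⊆ occStd x`;
* PARTICLE CONSERVATION `wt_psi_eq` by ALTERNATION: bit and height flip parity together along the orbit
  (`parity_orbit`), so the orientation of an unmatched wall is the parity of its level `mu`, and the unit-step law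
  crosses each of the (evenly many) levels once (`two_mul_sum_unmatched_bit`);
* INJECTIVITY `psi_injOn` by the MIRROR COUNT: the reflection-with-half-shift `A` turns left-unmatched O-walls of `z`
  into unmatched E-walls of `z ∘ A` (`leftUnm_iff`), so `card_leftUnm` is `card_unmatched` again; every moved wall is
  left-unmatched in `psi x` (`leftUnm_psi_of_unmatched`, future-minimum telescoping), hence the moved set is
  RECOVERED from the image (`unmatched_eq_leftUnm`) and `x` with it.
What is NOT here (the remaining glue to `BlockMixingPurity.Dominance.Reblocking π` on `Wire m`): the Pauli-string →
occupancy-word reduction (`s = 3t`) and the component-by-component hybrid over the alternating cycles of `std ∪ π`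
with conditioning on the other components (SKETCH.md §5 S1, S3).  Nothing here proves or refutes quantum advantage.
-/

noncomputable section

namespace Literature.Computability.QuantumComplexity.BlockMixingPurity.Dominance.Cycle

open Finset

variable {k : ℕ} [NeZero k]

/-- Positions of the alternating `2k`-cycle: (standard block, second wire?). [folklore] -/
abbrev Pos (k : ℕ) := ZMod k × Bool

/-- Occupied standard blocks `{i | x (i,0) ∨ x (i,1)}`. [folklore] -/
def occStd (x : Pos k → Bool) : Finset (ZMod k) := univ.filter fun i => x (i, false) = true ∨ x (i, true) = true

/-- Occupied `π`-blocks `{i | x (i,1) ∨ x (i+1,0)}`. [folklore] -/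
def occPi (x : Pos k → Bool) : Finset (ZMod k) := univ.filter fun i => x (i, true) = true ∨ x (i + 1, false) = true

/-- Number of occupied positions. [folklore] -/
def wt (x : Pos k → Bool) : ℕ := (univ.filter fun p => x p = true).card

/-- Number of mixed standard blocks (E-walls). [folklore] -/
def mixStd (x : Pos k → Bool) : ℕ := (univ.filter fun i : ZMod k => x (i, false) ≠ x (i, true)).card

/-- Number of mixed `π`-blocks (O-walls). [folklore] -/
def mixPi (x : Pos k → Bool) : ℕ := (univ.filter fun i : ZMod k => x (i, true) ≠ x (i + 1, false)).card

/-- The per-block identity behind `2·#occ = wt + mix`: for two bits `a b`,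
`2·[a ∨ b] = [a] + [b] + [a ≠ b]`. [folklore] -/
private theorem two_mul_ite_or (a b : Bool) :
    2 * (if (a = true ∨ b = true) then 1 else 0 : ℕ) =
      (if a = true then 1 else 0) + (if b = true then 1 else 0) + (if a ≠ b then 1 else 0) := by
  cases a <;> cases b <;> simp

/-- `wt` as a sum over standard blocks. [folklore] -/
private theorem wt_eq_sum_std (x : Pos k → Bool) :
    wt x = ∑ i : ZMod k, ((if x (i, false) = true then 1 else 0) + (if x (i, true) = true then 1 else 0) : ℕ) := by
  unfold wt
  rw [card_filter, Fintype.sum_prod_type]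
  refine sum_congr rfl fun i _ => ?_
  simp only [Fintype.sum_bool]
  ring

/-- `wt` as a sum over `π`-blocks (shift the first wire by one block). [folklore] -/
private theorem wt_eq_sum_pi (x : Pos k → Bool) :
    wt x = ∑ i : ZMod k, ((if x (i, true) = true then 1 else 0) + (if x (i + 1, false) = true then 1 else 0) : ℕ) := by
  rw [wt_eq_sum_std, sum_add_distrib, sum_add_distrib, add_comm]
  congr 1
  exact (Fintype.sum_equiv (Equiv.addRight (1 : ZMod k)) _ _ fun i => rfl).symm

/-- COUNTING IDENTITY (standard blocks): `2·#occStd x = wt x + mixStd x`. [cite: WareEtAl2023, arXiv pp. 6–7 (a gate layer on a matching; occupied blocks — bookkeeping identity of this construction)] -/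
theorem two_mul_card_occStd (x : Pos k → Bool) : 2 * (occStd x).card = wt x + mixStd x := by
  unfold occStd mixStd
  rw [card_filter, card_filter, wt_eq_sum_std, mul_sum, ← sum_add_distrib]
  exact sum_congr rfl fun i _ => two_mul_ite_or _ _

/-- COUNTING IDENTITY (`π`-blocks): `2·#occPi x = wt x + mixPi x`. [cite: WareEtAl2023, arXiv pp. 6–7 (a gate layer on a matching; occupied blocks — bookkeeping identity of this construction)] -/
theorem two_mul_card_occPi (x : Pos k → Bool) : 2 * (occPi x).card = wt x + mixPi x := by
  unfold occPi mixPi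
  rw [card_filter, card_filter, wt_eq_sum_pi, mul_sum, ← sum_add_distrib]
  exact sum_congr rfl fun i _ => two_mul_ite_or _ _

end Literature.Computability.QuantumComplexity.BlockMixingPurity.Dominance.Cycle

end
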